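import Literature.MathematicalPhysics.QuantumLattice.SectorPartitionFnCut
import Literature.MathematicalPhysics.QuantumLattice.TorusSectorPartitionFnTiling
import Literature.MathematicalPhysics.QuantumLattice.HubbardSzSectorLadder
import Literature.MathematicalPhysics.QuantumLattice.HubbardOneParticleCost
import Mathlib.Analysis.Normed.Algebra.MatrixExponential
import HarnessLib

/-!
# Canonical partition functions of ADJACENT particle-number sectors are comparable
# (finite-volume compressibility bound, the `T > 0` one-particle addition cost)

Topic `MathematicalPhysics/QuantumLattice` (thermal toolkit; the positive-temperature companion of the
one-particle addition cost `ThermodynamicLimit.groundEnergy_twoGraph_succ_le` of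
`HubbardOneParticleCost.lean` / `HubbardNNNHoppingThermodynamicLimit.lean`, which is the density-rounding
input of the `T = 0` thermodynamic limit). For a sector-preserving Hermitian `H` on the fermionic Fock space
of `Λ` (two spin species) with a volume-uniform commutator bound `‖[H, c†_{xσ}]‖ ≤ K` and `β ≥ 0`:

* `partitionFn_blockDiagonal_const` — `Z_β(⊕_{k ∈ κ} S) = |κ| · Z_β(S)` (identical diagonal blocks);
* `sum_star_creation_mulVec_dotProduct_of_support` — the LADDER IDENTITY
  `Σ_x ⟨c†_{xσ} ψ, c†_{xσ} φ⟩ = (|Λ| − N_σ) ⟨ψ, φ⟩` on a spin sector with `N_σ` electrons of spin `σ`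
  (`c c† = 1 − n`, `Σ_x n_{xσ} = N_σ`);
* **`partitionFn_submatrix_re_le_of_creation_ladder`** — the core estimate, for a coordinate sector `p`
  carried into a sector `p'` by every `c†_{k(x)}`, `x ∈ Λ`, with `Σ_x n_{k(x)} = N` on `p`, `N < |Λ|`:
  `Re Z_β(H|_p) ≤ |Λ| · exp(β K |Λ| / (|Λ| − N)) · Re Z_β(H|_{p'})`.
  PROOF (Peierls in `H|_{p'} ⊗ 1_Λ`): for the eigenbasis `χ_c` of `H|_p` the vectors
  `v_c = (|Λ| − N)^{−1/2} Σ_x (c†_{k(x)} χ_c) ⊗ e_x` are ORTHONORMAL in `ℓ²(p') ⊗ ℓ²(Λ)` (ladder identity),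
  and `⟨v_c, (H ⊗ 1) v_c⟩ = λ_c + (|Λ| − N)⁻¹ Σ_x ⟨c†_{k(x)} χ_c, [H, c†_{k(x)}] χ_c⟩ ≤ λ_c + K|Λ|/(|Λ| − N)`;
  Peierls' inequality for the orthonormal family `(v_c)` and the block-diagonal matrix `H|_{p'} ⊗ 1_Λ`
  (`IsHermitian.sum_exp_neg_mul_rayleigh_le_partitionFn`) gives `Σ_c e^{−βλ_c} ≤ e^{βK|Λ|/(|Λ|−N)} · |Λ| Z_β(H|_{p'})`.
* `partitionFn_spinSector_re_le_succ_up` / `…_succ_down` — for the two-graph Hubbard Hamiltonians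
  `H = hamiltonian G t U + hamiltonian G' t' U'` (degrees `≤ Δ, Δ'`):
  `Re Z_β(H; a, b) ≤ |Λ| e^{β K |Λ|/(|Λ| − a)} Re Z_β(H; a+1, b)` (`a < |Λ|`) and the same for `b ↦ b + 1`, with
  `K = 2(2Δ+1)(2|t|+|U|) + 2(2Δ'+1)(2|t'|+|U'|)` (`norm_commutator_hamiltonianWith_creation_le`);
  logarithmic forms `log Re Z(a,b) ≤ log |Λ| + βK|Λ|/(|Λ|−a) + log Re Z(a+1,b)` and the diagonal step
  `(a, a) → (a+1, a+1)`.

Uniformly in the volume at fixed density `a/|Λ| ≤ ν < 1` the loss is `log |Λ| + βK/(1−ν)` per added electron —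
`o(|Λ|)`, which is what the density-rounding step of the thermodynamic limit of the canonical free energy
consumes (Ruelle 1969 §3.4.3 for continuum systems; here for lattice fermions via Peierls' inequality).
Everything is PROVED; no definition, no named fact.

## Mathlib / tree search

REUSED: `Matrix.exp_blockDiagonal`, `Matrix.trace_blockDiagonal`, `Matrix.blockDiagonal_apply`,
`NormedSpace.map_exp` (Mathlib); `Matrix.IsHermitian.sum_exp_neg_mul_rayleigh_le_partitionFn`,
`Matrix.star_dotProduct_eq_subtype`, `Matrix.star_dotProduct_mulVec_eq_submatrix` (`PeierlsOrthonormalFamily`);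
`sectorEigenvector`, `sectorEigenvalue`, `star_sectorEigenvector_dotProduct`, `mulVec_sectorEigenvector`,
`sectorEigenvector_apply_of_not_mem` (`TorusSectorGibbsMixture`, `SectorPartitionFnCut`); `numberAt_eq_diagonal`,
`annihilation_mul_creation_add_creation_mul_annihilation_holds`, `star_mulVec_dotProduct`, `norm_toLp_sq`,
`norm_toLp_mulVec_le`, `norm_star_dotProduct_mulVec_le`, `norm_creation_le_one`
(`FermionOperators`, `HubbardOneParticleCost`, `HubbardGaugeBound`); `norm_commutator_hamiltonianWith_creation_le`
(`HubbardCommutatorBound`); `IsInSector.creation_up_mulVec`, `IsInSector.creation_down_mulVec` (`HubbardSzSectorLadder`);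
`apply_eq_zero_of_preservesSectors`, `preservesSectors_hamiltonian` (`SectorPartitionFnCut`, `HubbardLiebConfig`).
`lean search 'succ_up|adjacent.*sector|partitionFn.*succ'`: nothing of this kind (2026-08-27); the tree's
two-sector files bracket the LIMIT ratio `lim Z_{(k−1,k)}/Z_{(k,k)}` by EEB rows, not the finite-volume ratio.

## References

* D. Ruelle, *Statistical Mechanics: Rigorous Results* (1969), §2.5 (Peierls' inequality), §3.4.3 (canonical
  ensemble: particle-number changes cost `o(V)`). [cite: Ruelle1969, §3.4]
* B. Simon, *The Statistical Mechanics of Lattice Gases* I (1993), §II.8 (Peierls for orthonormal families).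
  [cite: Simon1993, §II.8]
* R. B. Israel, *Convexity in the Theory of Lattice Gases* (1979), §I.3 eq. (26) (canonical weights).
  [cite: Israel1979, §I.3 eq. (26)]
-/

noncomputable section

namespace Literature.MathematicalPhysics.QuantumLattice

open Matrix Finset HubbardWave0 ThermodynamicLimit LiebThm1
open scoped ComplexOrder BigOperators Matrix.Norms.L2Operator

namespace ThermodynamicLimit

/-! ### §1 Identical diagonal blocks -/

/-- **`Z_β(⊕_{k ∈ κ} S) = |κ| · Z_β(S)`**: the partition function of a block-diagonal matrix with identical
blocks (the matrix exponential is block diagonal, `Matrix.exp_blockDiagonal`). [cite: Simon1993, §II.8] -/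
theorem partitionFn_blockDiagonal_const {σ κ : Type*} [Fintype σ] [DecidableEq σ] [Fintype κ] [DecidableEq κ]
    (β : ℝ) (S : Matrix σ σ ℂ) :
    partitionFn β (blockDiagonal fun _ : κ => S) = Fintype.card κ * partitionFn β S := by
  unfold partitionFn gibbsWeight
  have h : -(β : ℂ) • blockDiagonal (fun _ : κ => S) = blockDiagonal (fun _ : κ => -(β : ℂ) • S) := by
    rw [← blockDiagonal_smul]; rfl
  have hk : ∀ k : κ, (NormedSpace.exp (fun _ : κ => -(β : ℂ) • S)) k = NormedSpace.exp (-(β : ℂ) • S) :=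
    fun k =>
      open scoped Matrix.Norms.Operator in
        NormedSpace.map_exp (Pi.evalRingHom (fun _ : κ => Matrix σ σ ℂ) k) (continuous_apply k) _
  rw [h, Matrix.exp_blockDiagonal, trace_blockDiagonal]
  simp_rw [hk]
  rw [Finset.sum_const, Finset.card_univ, nsmul_eq_mul]

/-- A block-diagonal matrix with Hermitian blocks is Hermitian. [cite: Simon1993, §II.8] -/
theorem isHermitian_blockDiagonal_const {σ κ : Type*} [DecidableEq κ] {S : Matrix σ σ ℂ}
    (hS : S.IsHermitian) : (blockDiagonal fun _ : κ => S).IsHermitian := by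
  unfold Matrix.IsHermitian
  rw [blockDiagonal_conjTranspose]
  congr 1
  funext k
  exact hS.eq

/-- Matrix–vector product of a block-diagonal matrix with identical blocks: block by block.
[cite: Simon1993, §II.8] -/
theorem blockDiagonal_const_mulVec_apply {σ κ : Type*} [Fintype σ] [Fintype κ] [DecidableEq κ]
    (S : Matrix σ σ ℂ) (w : σ × κ → ℂ) (s : σ) (k : κ) :
    (blockDiagonal (fun _ : κ => S) *ᵥ w) (s, k) = (S *ᵥ fun s' => w (s', k)) s := by
  simp only [mulVec, dotProduct]
  rw [Fintype.sum_prod_type]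
  refine Finset.sum_congr rfl fun s' _ => ?_
  rw [Finset.sum_eq_single k]
  · rw [blockDiagonal_apply_eq]
  · intro k' _ hk'
    rw [blockDiagonal_apply_ne _ _ _ (Ne.symm hk'), zero_mul]
  · intro hk; exact absurd (Finset.mem_univ k) hk

/-! ### §2 The ladder identity on a spin sector -/

section Ladder

variable {Λ : Type*} [LinearOrder Λ] [Fintype Λ]

/-- `⟨c†_k ψ, c†_k φ⟩ = ⟨ψ, φ⟩ − ⟨ψ, n_k φ⟩` (`c_k c†_k = 1 − n_k`). [cite: Tasaki2020, §9.2] -/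
theorem star_creation_mulVec_dotProduct_creation_mulVec (k : Orb Λ) (ψ φ : Fock (Orb Λ)) :
    star (creation k *ᵥ ψ) ⬝ᵥ (creation k *ᵥ φ) = star ψ ⬝ᵥ φ - star ψ ⬝ᵥ (numberAt k *ᵥ φ) := by
  rw [star_mulVec_dotProduct, creation, conjTranspose_conjTranspose, mulVec_mulVec, ← creation]
  have hcar := annihilation_mul_creation_add_creation_mul_annihilation_holds (ι := Orb Λ) k k
  rw [if_pos rfl] at hcar
  rw [show annihilation k * creation k = 1 - numberAt k from by
    rw [numberAt, ← hcar, add_sub_cancel_right], sub_mulVec, one_mulVec, dotProduct_sub]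

/-- On a vector supported in the spin sector `(a, b)` the number of spin-`σ` electrons acts as a scalar:
`(Σ_x n_{xσ}) φ = N_σ φ`, `N_0 = a`, `N_1 = b`. [cite: LiebPRL1989, proof of Theorem 1] -/
theorem sum_numberAt_orb_mulVec_of_support (σ : Fin 2) {a b : ℕ} {φ : Fock (Orb Λ)}
    (hφ : ∀ s, ¬ spinConfig a b s → φ s = 0) :
    (∑ x : Λ, numberAt (orb x σ)) *ᵥ φ = ((if σ = 0 then a else b : ℕ) : ℂ) • φ := by
  funext s
  rw [Matrix.sum_mulVec, Finset.sum_apply, Pi.smul_apply, smul_eq_mul]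
  have hterm : ∀ x : Λ, (numberAt (orb x σ) *ᵥ φ) s = (if orb x σ ∈ s then 1 else 0) * φ s := by
    intro x
    rw [numberAt_eq_diagonal, mulVec_diagonal]
  simp_rw [hterm]
  rw [← Finset.sum_mul, Finset.sum_boole]
  by_cases hs : spinConfig a b s
  · congr 2
    obtain ⟨hu, hd⟩ := hs
    fin_cases σ
    · simp only [Fin.zero_eta, Fin.isValue, ↓reduceIte]
      rw [← hu]; rfl
    · simp only [Fin.mk_one, Fin.isValue, one_ne_zero, ↓reduceIte]
      rw [← hd]; rfl
  · rw [hφ s hs, mul_zero, mul_zero]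

/-- **The ladder identity on a spin sector**: for `ψ, φ` supported in the sector `(a, b)`,
`Σ_x ⟨c†_{xσ} ψ, c†_{xσ} φ⟩ = (|Λ| − N_σ) ⟨ψ, φ⟩` (`Σ_x c_{xσ} c†_{xσ} = |Λ| − N̂_σ`).
[cite: Tasaki2020, §9.2] -/
theorem sum_star_creation_mulVec_dotProduct_of_support (σ : Fin 2) {a b : ℕ} {ψ φ : Fock (Orb Λ)}
    (hφ : ∀ s, ¬ spinConfig a b s → φ s = 0) :
    ∑ x : Λ, star (creation (orb x σ) *ᵥ ψ) ⬝ᵥ (creation (orb x σ) *ᵥ φ) =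
      ((Fintype.card Λ : ℂ) - ((if σ = 0 then a else b : ℕ) : ℂ)) * (star ψ ⬝ᵥ φ) := by
  simp_rw [star_creation_mulVec_dotProduct_creation_mulVec]
  rw [Finset.sum_sub_distrib, Finset.sum_const, Finset.card_univ, nsmul_eq_mul, ← dotProduct_sum,
    ← Matrix.sum_mulVec, sum_numberAt_orb_mulVec_of_support σ hφ, dotProduct_smul, smul_eq_mul]
  ring

end Ladder

/-! ### §3 The core estimate: Peierls in `H|_{p'} ⊗ 1_Λ` with the ladder family -/

section Core

variable {Λ : Type*} [LinearOrder Λ] [Fintype Λ]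

/-- `‖toLp v‖² = Re⟨v,v⟩`, so `Re⟨c†ψ, c†ψ⟩ ≤ 1` for a unit vector `ψ` (`‖c†‖ ≤ 1`). [cite: Tasaki2020, §9.2] -/
theorem re_star_creation_mulVec_dotProduct_self_le_one (k : Orb Λ) {ψ : Fock (Orb Λ)}
    (hψ : star ψ ⬝ᵥ ψ = 1) : (star (creation k *ᵥ ψ) ⬝ᵥ (creation k *ᵥ ψ)).re ≤ 1 := by
  have hnormψ : ‖(WithLp.toLp 2 ψ : EuclideanSpace ℂ (Finset (Orb Λ)))‖ = 1 := by
    have h := norm_toLp_sq ψ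
    rw [hψ, Complex.one_re] at h
    rwa [pow_eq_one_iff_of_nonneg (norm_nonneg _) two_ne_zero] at h
  rw [← norm_toLp_sq]
  have h1 : ‖(WithLp.toLp 2 (creation k *ᵥ ψ) : EuclideanSpace ℂ (Finset (Orb Λ)))‖ ≤ 1 := by
    calc _ ≤ ‖creation k‖ * ‖(WithLp.toLp 2 ψ : EuclideanSpace ℂ (Finset (Orb Λ)))‖ := norm_toLp_mulVec_le _ _
      _ ≤ 1 * 1 := by
          gcongr
          · exact norm_creation_le_one (ι := Orb Λ) k
          · exact hnormψ.le
      _ = 1 := one_mul _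
  nlinarith [norm_nonneg (WithLp.toLp 2 (creation k *ᵥ ψ) : EuclideanSpace ℂ (Finset (Orb Λ)))]

/-- `|⟨c†_k ψ, X ψ⟩| ≤ ‖X‖` for a unit vector `ψ`. [cite: Tasaki2020, §9.2] -/
theorem norm_star_creation_mulVec_dotProduct_mulVec_le (k : Orb Λ) (X : Matrix (Finset (Orb Λ)) (Finset (Orb Λ)) ℂ)
    {ψ : Fock (Orb Λ)} (hψ : star ψ ⬝ᵥ ψ = 1) : ‖star (creation k *ᵥ ψ) ⬝ᵥ (X *ᵥ ψ)‖ ≤ ‖X‖ := by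
  have hnormψ : ‖(WithLp.toLp 2 ψ : EuclideanSpace ℂ (Finset (Orb Λ)))‖ = 1 := by
    have h := norm_toLp_sq ψ
    rw [hψ, Complex.one_re] at h
    rwa [pow_eq_one_iff_of_nonneg (norm_nonneg _) two_ne_zero] at h
  have h1 : ‖(WithLp.toLp 2 (creation k *ᵥ ψ) : EuclideanSpace ℂ (Finset (Orb Λ)))‖ ≤ 1 := by
    calc _ ≤ ‖creation k‖ * ‖(WithLp.toLp 2 ψ : EuclideanSpace ℂ (Finset (Orb Λ)))‖ := norm_toLp_mulVec_le _ _
      _ ≤ 1 * 1 := by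
          gcongr
          · exact norm_creation_le_one (ι := Orb Λ) k
          · exact hnormψ.le
      _ = 1 := one_mul _
  refine (norm_star_dotProduct_mulVec_le _ _ _).trans ?_
  rw [hnormψ, mul_one]
  calc _ ≤ 1 * ‖X‖ := mul_le_mul_of_nonneg_right h1 (norm_nonneg _)
    _ = ‖X‖ := one_mul _

/-- **The core estimate.** Let `H` be Hermitian on the Fock space of `Λ`, `p`, `p'` coordinate sectors with
no entries of `H` between `p` and its complement, and `k : Λ → Orb Λ` a family of orbitals such that every
`c†_{k(x)}` carries vectors supported in `p` to vectors supported in `p'` and `Σ_x n_{k(x)} = N` on `p`,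
`N < |Λ|`. If `‖[H, c†_{k(x)}]‖ ≤ K` for all `x` and `β ≥ 0`, then
`Re Z_β(H|_p) ≤ |Λ| · exp(β K |Λ|/(|Λ| − N)) · Re Z_β(H|_{p'})`. [cite: Ruelle1969, §3.4] [cite: Simon1993, §II.8] -/
theorem partitionFn_submatrix_re_le_of_creation_ladder
    {H : Matrix (Finset (Orb Λ)) (Finset (Orb Λ)) ℂ} (hH : H.IsHermitian)
    (p p' : Finset (Orb Λ) → Prop) [DecidablePred p] [DecidablePred p']
    (hinv : ∀ s s', ¬ p s → p s' → H s s' = 0)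
    (k : Λ → Orb Λ) {N : ℕ} (hN : N < Fintype.card Λ)
    (hnum : ∀ ψ φ : Fock (Orb Λ), (∀ s, ¬ p s → φ s = 0) →
      ∑ x : Λ, star (creation (k x) *ᵥ ψ) ⬝ᵥ (creation (k x) *ᵥ φ) =
        ((Fintype.card Λ : ℂ) - (N : ℂ)) * (star ψ ⬝ᵥ φ))
    (hlad : ∀ φ : Fock (Orb Λ), (∀ s, ¬ p s → φ s = 0) → ∀ x s, ¬ p' s → (creation (k x) *ᵥ φ) s = 0)
    {K : ℝ} (hK : ∀ x, ‖H * creation (k x) - creation (k x) * H‖ ≤ K) {β : ℝ} (hβ : 0 ≤ β) :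
    (partitionFn β (H.submatrix (Subtype.val : Subtype p → _) Subtype.val)).re ≤
      Fintype.card Λ * Real.exp (β * K * Fintype.card Λ / (Fintype.card Λ - N)) *
        (partitionFn β (H.submatrix (Subtype.val : Subtype p' → _) Subtype.val)).re := by
  classical
  -- the volume defect `m = |Λ| − N > 0` and its square root
  set m : ℝ := (Fintype.card Λ : ℝ) - N with hm
  have hmpos : 0 < m := by rw [hm]; exact sub_pos.2 (by exact_mod_cast hN)
  set r : ℝ := Real.sqrt m with hr
  have hr0 : 0 < r := Real.sqrt_pos.2 hmpos
  have hrr : r * r = m := Real.mul_self_sqrt hmpos.le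
  -- the compressions
  set S' : Matrix (Subtype p') (Subtype p') ℂ := H.submatrix Subtype.val Subtype.val with hS'
  have hS'h : S'.IsHermitian := hH.submatrix Subtype.val
  set A : Matrix (Subtype p' × Λ) (Subtype p' × Λ) ℂ := blockDiagonal fun _ : Λ => S' with hA
  have hAh : A.IsHermitian := isHermitian_blockDiagonal_const hS'h
  -- eigen-data of the source sector
  set χ : Subtype p → Fock (Orb Λ) := fun c => sectorEigenvector p H hH c with hχ
  set lam : Subtype p → ℝ := fun c => sectorEigenvalue p H hH c with hlam
  have hχsupp : ∀ c s, ¬ p s → χ c s = 0 := fun c s hs => sectorEigenvector_apply_of_not_mem p H hH c hs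
  have hχon : ∀ c d, star (χ c) ⬝ᵥ χ d = if c = d then 1 else 0 :=
    fun c d => star_sectorEigenvector_dotProduct p H hH c d
  have hχ1 : ∀ c, star (χ c) ⬝ᵥ χ c = 1 := fun c => by rw [hχon, if_pos rfl]
  have hHχ : ∀ c, H *ᵥ χ c = ((lam c : ℝ) : ℂ) • χ c := fun c => mulVec_sectorEigenvector p hH hinv c
  have hZp : (partitionFn β (H.submatrix (Subtype.val : Subtype p → _) Subtype.val)).re =
      ∑ c, Real.exp (-(β * lam c)) := by
    rw [(hH.submatrix Subtype.val).partitionFn_eq_ofReal, Complex.ofReal_re]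
    rfl
  -- the ladder family in `ℓ²(p') ⊗ ℓ²(Λ)`
  set v : Subtype p → (Subtype p' × Λ → ℂ) :=
    fun c sx => ((r⁻¹ : ℝ) : ℂ) * (creation (k sx.2) *ᵥ χ c) sx.1.val with hv
  have hcsupp : ∀ c x s, ¬ p' s → (creation (k x) *ᵥ χ c) s = 0 := fun c x => hlad (χ c) (hχsupp c) x
  -- (a) inner products of the family, block by block
  have hvv : ∀ c d, star (v c) ⬝ᵥ v d =
      (((r⁻¹ : ℝ) : ℂ) * ((r⁻¹ : ℝ) : ℂ)) *
        ∑ x : Λ, star (creation (k x) *ᵥ χ c) ⬝ᵥ (creation (k x) *ᵥ χ d) := by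
    intro c d
    rw [dotProduct, Fintype.sum_prod_type_right, Finset.mul_sum]
    refine Finset.sum_congr rfl fun x _ => ?_
    rw [Matrix.star_dotProduct_eq_subtype p' (hcsupp d x), dotProduct, Finset.mul_sum]
    refine Finset.sum_congr rfl fun s _ => ?_
    simp only [hv, Pi.star_apply, star_mul', Complex.star_def, Complex.conj_ofReal]
    ring
  have hvon : ∀ c d, star (v c) ⬝ᵥ v d = if c = d then 1 else 0 := by
    intro c d
    rw [hvv, hnum (χ c) (χ d) (hχsupp d), hχon]
    split_ifs
    · rw [mul_one]
      have hmC : ((Fintype.card Λ : ℂ) - (N : ℂ)) = (m : ℂ) := by rw [hm]; push_cast; ring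
      rw [hmC, ← Complex.ofReal_mul, ← Complex.ofReal_mul, ← mul_inv, hrr, inv_mul_cancel₀ hmpos.ne',
        Complex.ofReal_one]
    · rw [mul_zero, mul_zero]
  -- (b) Rayleigh quotients of the family
  have hvAv : ∀ c, star (v c) ⬝ᵥ (A *ᵥ v c) =
      (((r⁻¹ : ℝ) : ℂ) * ((r⁻¹ : ℝ) : ℂ)) *
        ∑ x : Λ, star (creation (k x) *ᵥ χ c) ⬝ᵥ (H *ᵥ (creation (k x) *ᵥ χ c)) := by
    intro c
    rw [dotProduct, Fintype.sum_prod_type_right, Finset.mul_sum]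
    refine Finset.sum_congr rfl fun x _ => ?_
    rw [Matrix.star_dotProduct_mulVec_eq_submatrix p' H (hcsupp c x) (hcsupp c x), dotProduct, Finset.mul_sum]
    refine Finset.sum_congr rfl fun s _ => ?_
    have hAv : (A *ᵥ v c) (s, x) = ((r⁻¹ : ℝ) : ℂ) * (S' *ᵥ fun s' : Subtype p' => (creation (k x) *ᵥ χ c) s'.val) s := by
      rw [hA, blockDiagonal_const_mulVec_apply]
      simp only [hv, mulVec, dotProduct, Finset.mul_sum]
      refine Finset.sum_congr rfl fun s' _ => by ring
    rw [hAv]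
    simp only [hv, Pi.star_apply, star_mul', Complex.star_def, Complex.conj_ofReal, hS']
    ring
  -- (c) the commutator estimate: `Re Σ_x ⟨c†χ, H c†χ⟩ ≤ m λ + |Λ| K`
  have hsumRe : ∀ c, (∑ x : Λ, star (creation (k x) *ᵥ χ c) ⬝ᵥ (H *ᵥ (creation (k x) *ᵥ χ c))).re ≤
      m * lam c + Fintype.card Λ * K := by
    intro c
    have hsplit : ∀ x, H *ᵥ (creation (k x) *ᵥ χ c) =
        ((lam c : ℝ) : ℂ) • (creation (k x) *ᵥ χ c) + (H * creation (k x) - creation (k x) * H) *ᵥ χ c := by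
      intro x
      rw [sub_mulVec, ← mulVec_mulVec, ← mulVec_mulVec, hHχ c, mulVec_smul]
      abel
    simp_rw [hsplit, dotProduct_add, dotProduct_smul, smul_eq_mul]
    rw [Finset.sum_add_distrib, ← Finset.mul_sum, hnum (χ c) (χ c) (hχsupp c), hχ1, mul_one,
      Complex.add_re, Complex.re_sum]
    have h1 : ((lam c : ℝ) : ℂ) * ((Fintype.card Λ : ℂ) - (N : ℂ)) = ((lam c * m : ℝ) : ℂ) := by
      rw [hm]; push_cast; ring
    rw [h1, Complex.ofReal_re]
    have h2 : ∑ x : Λ, (star (creation (k x) *ᵥ χ c) ⬝ᵥ ((H * creation (k x) - creation (k x) * H) *ᵥ χ c)).re ≤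
        ∑ _x : Λ, K := Finset.sum_le_sum fun x _ =>
      (Complex.re_le_norm _).trans ((norm_star_creation_mulVec_dotProduct_mulVec_le (k x) _ (hχ1 c)).trans (hK x))
    rw [Finset.sum_const, Finset.card_univ, nsmul_eq_mul] at h2
    linarith
  have hRayleigh : ∀ c, (star (v c) ⬝ᵥ (A *ᵥ v c)).re ≤ lam c + K * Fintype.card Λ / m := by
    intro c
    rw [hvAv, ← Complex.ofReal_mul, Complex.re_ofReal_mul]
    have hrinv : r⁻¹ * r⁻¹ = m⁻¹ := by rw [← mul_inv, hrr]
    rw [hrinv]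
    have h := hsumRe c
    rw [show lam c + K * Fintype.card Λ / m = m⁻¹ * (m * lam c + Fintype.card Λ * K) by
      field_simp]
    exact mul_le_mul_of_nonneg_left h (inv_nonneg.2 hmpos.le)
  -- (d) Peierls for the family against `A = H|_{p'} ⊗ 1_Λ`
  have hPeierls := hAh.sum_exp_neg_mul_rayleigh_le_partitionFn β hvon
  have hZA : (partitionFn β A).re =
      Fintype.card Λ * (partitionFn β (H.submatrix (Subtype.val : Subtype p' → _) Subtype.val)).re := by
    have h : partitionFn β A = Fintype.card Λ * partitionFn β S' := by
      rw [hA]; convert partitionFn_blockDiagonal_const (κ := Λ) β S' using 2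
    rw [h, ← hS']
    simp [Complex.mul_re]
  -- (e) assemble
  have hstep : ∀ c, Real.exp (-(β * lam c)) ≤
      Real.exp (β * K * Fintype.card Λ / (Fintype.card Λ - N)) * Real.exp (-(β * (star (v c) ⬝ᵥ (A *ᵥ v c)).re)) := by
    intro c
    rw [← Real.exp_add]
    refine Real.exp_le_exp.2 ?_
    have h := mul_le_mul_of_nonneg_left (hRayleigh c) hβ
    rw [← hm]
    have e : β * K * Fintype.card Λ / m = β * (K * Fintype.card Λ / m) := by ring
    rw [e]
    nlinarith
  calc (partitionFn β (H.submatrix (Subtype.val : Subtype p → _) Subtype.val)).re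
      = ∑ c, Real.exp (-(β * lam c)) := hZp
    _ ≤ ∑ c, Real.exp (β * K * Fintype.card Λ / (Fintype.card Λ - N)) *
          Real.exp (-(β * (star (v c) ⬝ᵥ (A *ᵥ v c)).re)) := Finset.sum_le_sum fun c _ => hstep c
    _ = Real.exp (β * K * Fintype.card Λ / (Fintype.card Λ - N)) *
          ∑ c, Real.exp (-(β * (star (v c) ⬝ᵥ (A *ᵥ v c)).re)) := by rw [Finset.mul_sum]
    _ ≤ Real.exp (β * K * Fintype.card Λ / (Fintype.card Λ - N)) * (partitionFn β A).re :=
        mul_le_mul_of_nonneg_left hPeierls (Real.exp_pos _).le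
    _ = _ := by rw [hZA]; ring

end Core

/-! ### §4 The two-graph Hubbard Hamiltonians: adjacent spin sectors -/

section Hubbard

variable {Λ : Type*} [LinearOrder Λ] [Fintype Λ] (G G' : SimpleGraph Λ) [DecidableRel G.Adj] [DecidableRel G'.Adj]

/-- The volume-uniform commutator bound `‖[H_{G,G'}, c†_{xσ}]‖ ≤ K(G,G')`,
`K = 2(2Δ+1)(2|t|+|U|) + 2(2Δ'+1)(2|t'|+|U'|)` for bond sets of maximal degrees `≤ Δ, Δ'`.
[cite: Ruelle1969, §3.4] -/
theorem norm_commutator_twoGraph_creation_le {Δ Δ' : ℕ} (hΔ : ∀ x : Λ, #{y | G.Adj x y} ≤ Δ)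
    (hΔ' : ∀ x : Λ, #{y | G'.Adj x y} ≤ Δ') (t U t' U' : ℝ) (x : Λ) (σ : Fin 2) :
    ‖(hamiltonian G t U + hamiltonian G' t' U') * creation (orb x σ) -
        creation (orb x σ) * (hamiltonian G t U + hamiltonian G' t' U')‖ ≤
      (2 * Δ + 1 : ℕ) * (2 * (2 * |t| + |U|)) + (2 * Δ' + 1 : ℕ) * (2 * (2 * |t'| + |U'|)) := by
  have h1 := norm_commutator_hamiltonianWith_creation_le G hΔ t U 0 x σ
  have h2 := norm_commutator_hamiltonianWith_creation_le G' hΔ' t' U' 0 x σ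
  rw [hamiltonianWith_zero, abs_zero, mul_zero, add_zero] at h1 h2
  have hsplit : (hamiltonian G t U + hamiltonian G' t' U') * creation (orb x σ) -
      creation (orb x σ) * (hamiltonian G t U + hamiltonian G' t' U') =
      (hamiltonian G t U * creation (orb x σ) - creation (orb x σ) * hamiltonian G t U) +
        (hamiltonian G' t' U' * creation (orb x σ) - creation (orb x σ) * hamiltonian G' t' U') := by
    simp only [add_mul, mul_add]
    abel
  rw [hsplit]
  exact (norm_add_le _ _).trans (add_le_add h1 h2)

/-- **Adding a spin-up electron costs `o(|Λ|)` in free energy.** For the two-graph Hubbard Hamiltonian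
`H = hamiltonian G t U + hamiltonian G' t' U'` (degrees `≤ Δ, Δ'`), `β ≥ 0` and `a < |Λ|`:
`Re Z_β(H; a, b) ≤ |Λ| · exp(β K |Λ|/(|Λ| − a)) · Re Z_β(H; a+1, b)`,
`K = 2(2Δ+1)(2|t|+|U|) + 2(2Δ'+1)(2|t'|+|U'|)`. [cite: Ruelle1969, §3.4] [cite: Simon1993, §II.8] -/
theorem partitionFn_spinSector_re_le_succ_up {Δ Δ' : ℕ} (hΔ : ∀ x : Λ, #{y | G.Adj x y} ≤ Δ)
    (hΔ' : ∀ x : Λ, #{y | G'.Adj x y} ≤ Δ') (t U t' U' : ℝ) {β : ℝ} (hβ : 0 ≤ β) {a : ℕ}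
    (ha : a < Fintype.card Λ) (b : ℕ) :
    (partitionFn β (spinSectorHamiltonian a b (hamiltonian G t U + hamiltonian G' t' U'))).re ≤
      Fintype.card Λ *
        Real.exp (β * ((2 * Δ + 1 : ℕ) * (2 * (2 * |t| + |U|)) + (2 * Δ' + 1 : ℕ) * (2 * (2 * |t'| + |U'|))) *
          Fintype.card Λ / (Fintype.card Λ - a)) *
        (partitionFn β (spinSectorHamiltonian (a + 1) b (hamiltonian G t U + hamiltonian G' t' U'))).re := by
  have hH : (hamiltonian G t U + hamiltonian G' t' U').IsHermitian :=
    (hamiltonian_isHermitian G t U).add (hamiltonian_isHermitian G' t' U')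
  have hP : PreservesSectors (hamiltonian G t U + hamiltonian G' t' U') :=
    (preservesSectors_hamiltonian G t U).add (preservesSectors_hamiltonian G' t' U')
  refine partitionFn_submatrix_re_le_of_creation_ladder hH (spinConfig a b) (spinConfig (a + 1) b)
    (fun s s' hs hs' => apply_eq_zero_of_preservesSectors hP a b s s' hs hs') (fun x => orb x 0) ha
    (fun ψ φ hφ => ?_) (fun φ hφ x => ?_) (fun x => norm_commutator_twoGraph_creation_le G G' hΔ hΔ' t U t' U' x 0) hβ
  · rw [sum_star_creation_mulVec_dotProduct_of_support 0 hφ, if_pos rfl]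
  · exact (isInSector_iff_support _ _ _).1 (IsInSector.creation_up_mulVec ((isInSector_iff_support a b φ).2 hφ) x)

/-- **Adding a spin-down electron costs `o(|Λ|)` in free energy**: for `β ≥ 0` and `b < |Λ|`,
`Re Z_β(H; a, b) ≤ |Λ| · exp(β K |Λ|/(|Λ| − b)) · Re Z_β(H; a, b+1)`. [cite: Ruelle1969, §3.4] [cite: Simon1993, §II.8] -/
theorem partitionFn_spinSector_re_le_succ_down {Δ Δ' : ℕ} (hΔ : ∀ x : Λ, #{y | G.Adj x y} ≤ Δ)
    (hΔ' : ∀ x : Λ, #{y | G'.Adj x y} ≤ Δ') (t U t' U' : ℝ) {β : ℝ} (hβ : 0 ≤ β) (a : ℕ) {b : ℕ}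
    (hb : b < Fintype.card Λ) :
    (partitionFn β (spinSectorHamiltonian a b (hamiltonian G t U + hamiltonian G' t' U'))).re ≤
      Fintype.card Λ *
        Real.exp (β * ((2 * Δ + 1 : ℕ) * (2 * (2 * |t| + |U|)) + (2 * Δ' + 1 : ℕ) * (2 * (2 * |t'| + |U'|))) *
          Fintype.card Λ / (Fintype.card Λ - b)) *
        (partitionFn β (spinSectorHamiltonian a (b + 1) (hamiltonian G t U + hamiltonian G' t' U'))).re := by
  have hH : (hamiltonian G t U + hamiltonian G' t' U').IsHermitian :=
    (hamiltonian_isHermitian G t U).add (hamiltonian_isHermitian G' t' U')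
  have hP : PreservesSectors (hamiltonian G t U + hamiltonian G' t' U') :=
    (preservesSectors_hamiltonian G t U).add (preservesSectors_hamiltonian G' t' U')
  refine partitionFn_submatrix_re_le_of_creation_ladder hH (spinConfig a b) (spinConfig a (b + 1))
    (fun s s' hs hs' => apply_eq_zero_of_preservesSectors hP a b s s' hs hs') (fun x => orb x 1) hb
    (fun ψ φ hφ => ?_) (fun φ hφ x => ?_) (fun x => norm_commutator_twoGraph_creation_le G G' hΔ hΔ' t U t' U' x 1) hβ
  · rw [sum_star_creation_mulVec_dotProduct_of_support 1 hφ, if_neg one_ne_zero]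
  · exact (isInSector_iff_support _ _ _).1 (IsInSector.creation_down_mulVec ((isInSector_iff_support a b φ).2 hφ) x)

/-- **The diagonal step `(a, a) → (a+1, a+1)`** (`β ≥ 0`, `a < |Λ|`):
`Re Z_β(H; a, a) ≤ (|Λ| e^{βK|Λ|/(|Λ|−a)})² · Re Z_β(H; a+1, a+1)` — one particle of each spin.
[cite: Ruelle1969, §3.4] [cite: Simon1993, §II.8] -/
theorem partitionFn_spinSector_re_le_succ_succ {Δ Δ' : ℕ} (hΔ : ∀ x : Λ, #{y | G.Adj x y} ≤ Δ)
    (hΔ' : ∀ x : Λ, #{y | G'.Adj x y} ≤ Δ') (t U t' U' : ℝ) {β : ℝ} (hβ : 0 ≤ β) {a : ℕ}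
    (ha : a < Fintype.card Λ) :
    (partitionFn β (spinSectorHamiltonian a a (hamiltonian G t U + hamiltonian G' t' U'))).re ≤
      (Fintype.card Λ *
        Real.exp (β * ((2 * Δ + 1 : ℕ) * (2 * (2 * |t| + |U|)) + (2 * Δ' + 1 : ℕ) * (2 * (2 * |t'| + |U'|))) *
          Fintype.card Λ / (Fintype.card Λ - a))) ^ 2 *
        (partitionFn β (spinSectorHamiltonian (a + 1) (a + 1) (hamiltonian G t U + hamiltonian G' t' U'))).re := by
  set C := (Fintype.card Λ : ℝ) *
    Real.exp (β * ((2 * Δ + 1 : ℕ) * (2 * (2 * |t| + |U|)) + (2 * Δ' + 1 : ℕ) * (2 * (2 * |t'| + |U'|))) *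
      Fintype.card Λ / (Fintype.card Λ - a)) with hC
  have hC0 : 0 ≤ C := by rw [hC]; positivity
  have h1 := partitionFn_spinSector_re_le_succ_up G G' hΔ hΔ' t U t' U' hβ ha a
  have h2 := partitionFn_spinSector_re_le_succ_down G G' hΔ hΔ' t U t' U' hβ (a + 1) ha
  rw [← hC] at h1 h2
  calc _ ≤ C * (partitionFn β (spinSectorHamiltonian (a + 1) a (hamiltonian G t U + hamiltonian G' t' U'))).re := h1
    _ ≤ C * (C * (partitionFn β (spinSectorHamiltonian (a + 1) (a + 1)
        (hamiltonian G t U + hamiltonian G' t' U'))).re) := mul_le_mul_of_nonneg_left h2 hC0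
    _ = _ := by ring

/-- **Logarithmic form of the diagonal step** (nonempty sectors, `β ≥ 0`, `a < |Λ|`):
`log Re Z_β(H; a, a) ≤ 2 (log |Λ| + βK|Λ|/(|Λ|−a)) + log Re Z_β(H; a+1, a+1)` — the free-energy price of one
electron pair is `O(log |Λ|) + O(β)`, i.e. `o(|Λ|)`. [cite: Ruelle1969, §3.4] -/
theorem log_partitionFn_spinSector_le_succ_succ {Δ Δ' : ℕ} (hΔ : ∀ x : Λ, #{y | G.Adj x y} ≤ Δ)
    (hΔ' : ∀ x : Λ, #{y | G'.Adj x y} ≤ Δ') (t U t' U' : ℝ) {β : ℝ} (hβ : 0 ≤ β) {a : ℕ}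
    (ha : a + 1 ≤ Fintype.card Λ) :
    Real.log (partitionFn β (spinSectorHamiltonian a a (hamiltonian G t U + hamiltonian G' t' U'))).re ≤
      2 * (Real.log (Fintype.card Λ) +
        β * ((2 * Δ + 1 : ℕ) * (2 * (2 * |t| + |U|)) + (2 * Δ' + 1 : ℕ) * (2 * (2 * |t'| + |U'|))) *
          Fintype.card Λ / (Fintype.card Λ - a)) +
      Real.log (partitionFn β (spinSectorHamiltonian (a + 1) (a + 1) (hamiltonian G t U + hamiltonian G' t' U'))).re := by
  have ha' : a < Fintype.card Λ := ha
  set K := ((2 * Δ + 1 : ℕ) * (2 * (2 * |t| + |U|)) + (2 * Δ' + 1 : ℕ) * (2 * (2 * |t'| + |U'|)) : ℝ) with hK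
  have hH : (hamiltonian G t U + hamiltonian G' t' U').IsHermitian :=
    (hamiltonian_isHermitian G t U).add (hamiltonian_isHermitian G' t' U')
  haveI : Nonempty (Subtype (spinConfig (Λ := Λ) a a)) := nonempty_spinConfig ha'.le ha'.le
  haveI : Nonempty (Subtype (spinConfig (Λ := Λ) (a + 1) (a + 1))) := nonempty_spinConfig ha ha
  have hZ0 : 0 < (partitionFn β (spinSectorHamiltonian a a (hamiltonian G t U + hamiltonian G' t' U'))).re :=
    partitionFn_spinSector_re_pos hH β
  have hZ1 : 0 < (partitionFn β (spinSectorHamiltonian (a + 1) (a + 1)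
      (hamiltonian G t U + hamiltonian G' t' U'))).re :=
    partitionFn_spinSector_re_pos hH β
  have hcard : (0 : ℝ) < Fintype.card Λ := by exact_mod_cast Nat.lt_of_le_of_lt (Nat.zero_le a) ha'
  have h := partitionFn_spinSector_re_le_succ_succ G G' hΔ hΔ' t U t' U' hβ ha'
  rw [← hK] at h
  have hlog := Real.log_le_log hZ0 h
  rw [Real.log_mul (by positivity) hZ1.ne', Real.log_pow, Real.log_mul hcard.ne' (Real.exp_pos _).ne',
    Real.log_exp] at hlog
  simpa [hK] using hlog

end Hubbard

end ThermodynamicLimit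

end Literature.MathematicalPhysics.QuantumLattice
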